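import Literature.NumberTheory.LocalFields.StrassmannTheorem
import HarnessLib

/-!
# Strassman disc certificates: a finite valuation table plus a tail bound certify «at most `k` zeros»

Topic `Literature/Computation/Certificates`; namespace `Literature.Computation.Certificates`. The analytic content
is Strassman's theorem, ALREADY PROVED in the tree (`Literature.NumberTheory.LocalFields.strassmann`,
Gouvêa, *p-adic Numbers*, Thm. 5.6.1; its `ℤ_p` form `strassmann_padicInt`). This file is the bookkeeping layer a
CHECKABLE CERTIFICATE needs (certified rational-points stack, kind «SD» of `pub/certnum/nt/FORMAT-ratpcert-v0.md`):
in practice the coefficients `aₙ` of the power series `f(X) = Σ aₙ Xⁿ` (a Coleman integral on a residue disc, a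
`p`-adic `L`-function, …) are known only as residues modulo `ϖᴺ` for `n ≤ M`, together with a proved TAIL bound for
`n > M`. Such data never determines `‖aₙ‖` for every `n`, but it does give

* an EXACT norm `‖a_k‖ = ‖ϖ‖ᵉ` for one index `k` (a residue of exact valuation `e < N`),
* LOWER bounds `lb n` on the valuation of every other tabulated coefficient (`‖aₙ‖ ≤ ‖ϖ‖^{lb n}`: a non-zero residue
  gives its valuation, a zero residue gives `N`), and
* a lower bound `tail` for all coefficients beyond the table,

and the four hypotheses of Strassman's theorem at index `k` follow from the purely combinatorial condition
`Valid`: `e ≤ lb n` for `n < k`, `e < lb n` for tabulated `n > k`, and `e < tail`. That condition is decidable on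
literals (`check : Bool`, `valid_of_check`), so a concrete certificate is discharged by `decide`/`rfl`, while the
statement «the table DESCRIBES the actual series» (`Describes`) is the producer's obligation (exact residue
arithmetic + a named truncation bound), separated cleanly from the theorem.

* `StrassmannDiscCert` (data: `table`, `k`, `e`, `tail`), `lb`, `Valid`, `check`, `valid_of_check`;
* `Describes c ϖ a` — what the certificate asserts about `a : ℕ → K` relative to an element `ϖ`, `0 < ‖ϖ‖ < 1`;
* **`exists_finset_zeros`** — over any complete non-archimedean field: a `Finset` of card `≤ k` containing every
  zero with `‖x‖ ≤ 1`; `ncard_zeros_le` (set form, finite and `ncard ≤ k`); `card_le_of_zeros` (any finite set of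
  zeros in the closed unit ball has at most `k` elements — the form a Chabauty–Coleman argument consumes, the
  inclusion «rational points in the disc ↦ zeros of the integral» being Coleman's theorem, a named fact NOT typed
  here for lack of curve / `p`-adic-integration carriers in the tree);
* `DescribesPadic c a` and **`exists_finset_zeros_padicInt`** — the `ℚ_p` form with `ϖ = p` and the table read as
  bounds on `Padic.valuation` (the shape an exact `ℤ/pᴺ` checker emits), via `Padic.norm_eq_zpow_neg_valuation`.

No new analysis; no named fact is used in any proof. Deliberately NOT here: how residues are computed (Kedlaya /
Coleman integration), the truncation bounds themselves (Balakrishnan–Bradshaw–Kedlaya-type lemmas, per instance),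
discs of other radii (rescale `aₙ ↦ aₙϖⁿ` before tabulating, cf. `strassmann_closedBall`).

## References

* F. Q. Gouvêa, *p-adic Numbers: An Introduction*, Universitext, Springer 1993, §5.6 Thm. 5.6.1.
  [Gouvea1993PadicNumbers]
* R. F. Coleman, Effective Chabauty, Duke Math. J. 52 (1985) 765–770 (the consumer of such zero counts).
  [Coleman1985EffectiveChabauty]
-/

noncomputable section

open Filter Topology

namespace Literature.Computation.Certificates

/-- A **Strassman disc certificate**: `table[n]` is a certified lower bound for the valuation (exponent of `ϖ`)
of the `n`-th coefficient for `n < table.length`; `k` is the claimed Strassman index, `e` the exact valuation of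
the `k`-th coefficient, `tail` a valuation lower bound for every coefficient beyond the table.
[cite: Gouvea1993PadicNumbers, §5.6 Thm. 5.6.1 (the index N of the theorem)] -/
structure StrassmannDiscCert where
  /-- valuation lower bounds of the tabulated coefficients `a₀, …, a_{M}` (`M + 1 = table.length`) -/
  table : List ℤ
  /-- the claimed Strassman index -/
  k : ℕ
  /-- the exact valuation of `a_k` -/
  e : ℤ
  /-- valuation lower bound for all coefficients `aₙ`, `n ≥ table.length` -/
  tail : ℤ

namespace StrassmannDiscCert

/-- The certified valuation lower bound at index `n`: the table entry, or the tail bound beyond the table.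
[cite: Gouvea1993PadicNumbers, §5.6 Thm. 5.6.1] -/
def lb (c : StrassmannDiscCert) (n : ℕ) : ℤ := c.table.getD n c.tail

/-- **Validity** of a certificate (pure integer bookkeeping): `k` is tabulated, `e ≤ lb n` before `k`, `e < lb n`
after `k` inside the table, and `e < tail`. [cite: Gouvea1993PadicNumbers, §5.6 Thm. 5.6.1 (hypotheses on N)] -/
def Valid (c : StrassmannDiscCert) : Prop :=
  c.k < c.table.length ∧ (∀ n < c.k, c.e ≤ c.lb n) ∧
    (∀ n < c.table.length, c.k < n → c.e < c.lb n) ∧ c.e < c.tail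

/-- Boolean checker for `Valid` (kernel-evaluable: `decide` / `rfl` on literals).
[cite: Gouvea1993PadicNumbers, §5.6 Thm. 5.6.1 (hypotheses on N)] -/
def check (c : StrassmannDiscCert) : Bool :=
  decide (c.k < c.table.length ∧ (∀ n < c.k, c.e ≤ c.lb n) ∧
    (∀ n < c.table.length, c.k < n → c.e < c.lb n) ∧ c.e < c.tail)

/-- `check = true` proves `Valid`. [cite: Gouvea1993PadicNumbers, §5.6 Thm. 5.6.1 (hypotheses on N)] -/
theorem valid_of_check (c : StrassmannDiscCert) (h : c.check = true) : c.Valid := by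
  unfold Valid
  unfold check at h
  exact of_decide_eq_true h

variable {c : StrassmannDiscCert}

/-- Beyond the table the bound is the tail bound (the tail hypothesis `|aₙ| < |a_N|` for all large `n`).
[cite: Gouvea1993PadicNumbers, §5.6 Thm. 5.6.1 (second condition on N)] -/
theorem lb_of_length_le {n : ℕ} (hn : c.table.length ≤ n) : c.lb n = c.tail := by
  unfold lb
  rw [List.getD_eq_getElem?_getD, List.getElem?_eq_none_iff.2 hn, Option.getD_none]

/-- A valid certificate bounds every other coefficient's valuation below by `e`.
[cite: Gouvea1993PadicNumbers, §5.6 Thm. 5.6.1 (|aₙ| ≤ |a_N|)] -/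
theorem e_le_lb (hc : c.Valid) {n : ℕ} (hn : n ≠ c.k) : c.e ≤ c.lb n := by
  obtain ⟨hk, h1, h2, h3⟩ := hc
  rcases lt_or_gt_of_ne hn with h | h
  · exact h1 n h
  · by_cases hl : n < c.table.length
    · exact (h2 n hl h).le
    · rw [lb_of_length_le (not_lt.1 hl)]; exact h3.le

/-- A valid certificate bounds every later coefficient's valuation STRICTLY below by `e`.
[cite: Gouvea1993PadicNumbers, §5.6 Thm. 5.6.1 (|aₙ| < |a_N| for n > N)] -/
theorem e_lt_lb (hc : c.Valid) {n : ℕ} (hn : c.k < n) : c.e < c.lb n := by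
  obtain ⟨hk, h1, h2, h3⟩ := hc
  by_cases hl : n < c.table.length
  · exact h2 n hl hn
  · rw [lb_of_length_le (not_lt.1 hl)]; exact h3

section General

variable {K : Type*} [NontriviallyNormedField K]

variable (c) in
/-- What the certificate ASSERTS about an actual coefficient sequence `a : ℕ → K`, measured against an element `ϖ`
(`0 < ‖ϖ‖ < 1`; `ϖ = p` in `ℚ_p` and its unramified extensions, a uniformiser in general): `aₙ → 0`, `a_k ≠ 0` with
`‖a_k‖ = ‖ϖ‖ᵉ` exactly, and `‖aₙ‖ ≤ ‖ϖ‖^{lb n}` for every `n ≠ k` — the producer's obligation (exact residues +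
a named tail bound), not proved here. [cite: Gouvea1993PadicNumbers, §5.6 Thm. 5.6.1] -/
def Describes (ϖ : K) (a : ℕ → K) : Prop :=
  Tendsto a atTop (𝓝 0) ∧ a c.k ≠ 0 ∧ ‖a c.k‖ = ‖ϖ‖ ^ c.e ∧ ∀ n, n ≠ c.k → ‖a n‖ ≤ ‖ϖ‖ ^ c.lb n

/-- From a valid certificate describing `a`: `‖aₙ‖ ≤ ‖a_k‖` for all `n`.
[cite: Gouvea1993PadicNumbers, §5.6 Thm. 5.6.1 (first hypothesis)] -/
theorem norm_le_of_describes (hc : c.Valid) {ϖ : K} (hϖ0 : ϖ ≠ 0) (hϖ1 : ‖ϖ‖ < 1) {a : ℕ → K}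
    (ha : c.Describes ϖ a) (n : ℕ) : ‖a n‖ ≤ ‖a c.k‖ := by
  by_cases hn : n = c.k
  · rw [hn]
  · rw [ha.2.2.1]
    exact (ha.2.2.2 n hn).trans
      (zpow_le_zpow_right_of_le_one₀ (norm_pos_iff.2 hϖ0) hϖ1.le (e_le_lb hc hn))

/-- From a valid certificate describing `a`: `‖aₙ‖ < ‖a_k‖` for all `n > k`.
[cite: Gouvea1993PadicNumbers, §5.6 Thm. 5.6.1 (second hypothesis)] -/
theorem norm_lt_of_describes (hc : c.Valid) {ϖ : K} (hϖ0 : ϖ ≠ 0) (hϖ1 : ‖ϖ‖ < 1) {a : ℕ → K}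
    (ha : c.Describes ϖ a) {n : ℕ} (hn : c.k < n) : ‖a n‖ < ‖a c.k‖ := by
  rw [ha.2.2.1]
  exact (ha.2.2.2 n hn.ne').trans_lt
    (zpow_lt_zpow_right_of_lt_one₀ (norm_pos_iff.2 hϖ0) hϖ1 (e_lt_lb hc hn))

variable [IsUltrametricDist K] [CompleteSpace K]

variable (c) in
/-- **Soundness of Strassman disc certificates** over any complete non-archimedean field: a valid certificate
that describes `a` yields a finite set of at most `k` elements containing every zero `x`, `‖x‖ ≤ 1`, of
`x ↦ Σ aₙxⁿ` — Strassman's theorem (Gouvêa Thm. 5.6.1, `Literature.NumberTheory.LocalFields.strassmann`) with its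
hypotheses read off the table. [cite: Gouvea1993PadicNumbers, §5.6 Thm. 5.6.1] -/
theorem exists_finset_zeros (hc : c.Valid) {ϖ : K} (hϖ0 : ϖ ≠ 0) (hϖ1 : ‖ϖ‖ < 1) {a : ℕ → K}
    (ha : c.Describes ϖ a) :
    ∃ s : Finset K, s.card ≤ c.k ∧ ∀ x : K, ‖x‖ ≤ 1 → ∑' n, a n * x ^ n = 0 → x ∈ s :=
  Literature.NumberTheory.LocalFields.strassmann c.k a ha.1 ha.2.1
    (norm_le_of_describes hc hϖ0 hϖ1 ha) (fun _ hn => norm_lt_of_describes hc hϖ0 hϖ1 ha hn)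

variable (c) in
/-- Set form: the zeros in the closed unit ball form a finite set of at most `k` elements.
[cite: Gouvea1993PadicNumbers, §5.6 Thm. 5.6.1] -/
theorem ncard_zeros_le (hc : c.Valid) {ϖ : K} (hϖ0 : ϖ ≠ 0) (hϖ1 : ‖ϖ‖ < 1) {a : ℕ → K}
    (ha : c.Describes ϖ a) :
    {x : K | ‖x‖ ≤ 1 ∧ ∑' n, a n * x ^ n = 0}.Finite ∧
      {x : K | ‖x‖ ≤ 1 ∧ ∑' n, a n * x ^ n = 0}.ncard ≤ c.k :=
  Literature.NumberTheory.LocalFields.strassmann_finite ha.1 ha.2.1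
    (norm_le_of_describes hc hϖ0 hϖ1 ha) (fun _ hn => norm_lt_of_describes hc hϖ0 hϖ1 ha hn)

variable (c) in
/-- **The form a Chabauty–Coleman disc argument consumes**: any finite set of points of the closed unit ball on
which the series vanishes has at most `k` elements (apply it to the image of the rational points of a residue disc,
which lie among the zeros of the Coleman integral by Coleman's theorem — a named fact of the consumer, not typed
here). [cite: Gouvea1993PadicNumbers, §5.6 Thm. 5.6.1] [cite: Coleman1985EffectiveChabauty, §1 (ii)] -/
theorem card_le_of_zeros (hc : c.Valid) {ϖ : K} (hϖ0 : ϖ ≠ 0) (hϖ1 : ‖ϖ‖ < 1) {a : ℕ → K}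
    (ha : c.Describes ϖ a) (S : Finset K) (hS : ∀ x ∈ S, ‖x‖ ≤ 1 ∧ ∑' n, a n * x ^ n = 0) :
    S.card ≤ c.k := by
  classical
  obtain ⟨s, hs, hmem⟩ := exists_finset_zeros c hc hϖ0 hϖ1 ha
  exact (Finset.card_le_card fun x hx => hmem x (hS x hx).1 (hS x hx).2).trans hs

end General

section Padic

variable {p : ℕ} [Fact p.Prime]

variable (c) in
/-- The `ℚ_p` reading of a certificate, in VALUATIONS (what an exact `ℤ/pᴺ` checker emits): `aₙ → 0`, `a_k ≠ 0`
with `v_p(a_k) = e`, and for `n ≠ k` either `aₙ = 0` or `lb n ≤ v_p(aₙ)`.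
[cite: Gouvea1993PadicNumbers, §5.6 Thm. 5.6.1] -/
def DescribesPadic (a : ℕ → ℚ_[p]) : Prop :=
  Tendsto a atTop (𝓝 0) ∧ a c.k ≠ 0 ∧ (a c.k).valuation = c.e ∧
    ∀ n, n ≠ c.k → a n = 0 ∨ c.lb n ≤ (a n).valuation

/-- Valuation data give the norm data with `ϖ = p`. [cite: Gouvea1993PadicNumbers, §5.6 Thm. 5.6.1] -/
theorem describes_of_describesPadic {a : ℕ → ℚ_[p]} (ha : c.DescribesPadic a) :
    c.Describes (p : ℚ_[p]) a := by
  have hp1 : (1 : ℝ) < p := Nat.one_lt_cast.2 (Fact.out : p.Prime).one_lt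
  have hnp : ‖(p : ℚ_[p])‖ = (p : ℝ)⁻¹ := Padic.norm_p
  obtain ⟨h1, h2, h3, h4⟩ := ha
  refine ⟨h1, h2, ?_, fun n hn => ?_⟩
  · rw [Padic.norm_eq_zpow_neg_valuation h2, h3, hnp, inv_zpow', zpow_neg]
  · rcases h4 n hn with h0 | hv
    · rw [h0, norm_zero]; positivity
    · by_cases h0 : a n = 0
      · rw [h0, norm_zero]; positivity
      · rw [Padic.norm_eq_zpow_neg_valuation h0, hnp, inv_zpow', zpow_neg, zpow_neg]
        exact inv_anti₀ (zpow_pos (by positivity) _) (zpow_le_zpow_right₀ hp1.le hv)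

variable (c) in
/-- **Soundness over `ℚ_p`, the printed shape** `f : ℤ_p → ℚ_p`: a valid certificate describing `a` in valuations
yields a `Finset ℤ_[p]` of card `≤ k` containing every zero of `x ↦ Σ aₙxⁿ` on `ℤ_p`
(`Literature.NumberTheory.LocalFields.strassmann_padicInt`). [cite: Gouvea1993PadicNumbers, §5.6 Thm. 5.6.1] -/
theorem exists_finset_zeros_padicInt (hc : c.Valid) {a : ℕ → ℚ_[p]} (ha : c.DescribesPadic a) :
    ∃ s : Finset ℤ_[p], s.card ≤ c.k ∧ ∀ x : ℤ_[p], ∑' n, a n * (x : ℚ_[p]) ^ n = 0 → x ∈ s := by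
  have hp0 : (p : ℚ_[p]) ≠ 0 := Nat.cast_ne_zero.2 (Fact.out : p.Prime).ne_zero
  have hp1 : ‖(p : ℚ_[p])‖ < 1 := by
    rw [Padic.norm_p]; exact inv_lt_one_of_one_lt₀ (Nat.one_lt_cast.2 (Fact.out : p.Prime).one_lt)
  have hd := describes_of_describesPadic ha
  exact Literature.NumberTheory.LocalFields.strassmann_padicInt hd.1 hd.2.1
    (norm_le_of_describes hc hp0 hp1 hd) (fun _ hn => norm_lt_of_describes hc hp0 hp1 hd hn)

variable (c) in
/-- `ℚ_p` consumption form: a finite set of zeros in `ℤ_p` has at most `k` elements; with the Boolean checker as the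
validity hypothesis (discharged by `decide` on a literal certificate).
[cite: Gouvea1993PadicNumbers, §5.6 Thm. 5.6.1] [cite: Coleman1985EffectiveChabauty, §1 (ii)] -/
theorem card_le_of_zeros_padicInt (hc : c.check = true) {a : ℕ → ℚ_[p]} (ha : c.DescribesPadic a)
    (S : Finset ℤ_[p]) (hS : ∀ x ∈ S, ∑' n, a n * (x : ℚ_[p]) ^ n = 0) : S.card ≤ c.k := by
  classical
  obtain ⟨s, hs, hmem⟩ := exists_finset_zeros_padicInt c (valid_of_check c hc) ha
  exact (Finset.card_le_card fun x hx => hmem x (hS x hx)).trans hs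

end Padic

/-- Kernel check of the Boolean validity test on a toy table (`M = 4`, `k = 2`, `e = 0`, tail bound `3`):
valuations `(1, 2, 0, 1, 5)`, so `e ≤ lb n` for `n < 2` and `e < lb n` for `n > 2`. [folklore] -/
example : ({ table := [1, 2, 0, 1, 5], k := 2, e := 0, tail := 3 } : StrassmannDiscCert).check = true := by
  decide

/-- … and a table that is NOT a certificate for `k = 2` (a later coefficient of the same valuation). [folklore] -/
example : ({ table := [1, 2, 0, 0, 5], k := 2, e := 0, tail := 3 } : StrassmannDiscCert).check = false := by
  decide

end StrassmannDiscCert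

end Literature.Computation.Certificates
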